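import Mathlib
import HarnessLib

/-!
# Rational signature subspaces of a Weil form from its real signature (the bridge to Hodge–Riemann)

Family `hodge`, layer `Literature/AlgebraicGeometry/Motives`. Pure linear algebra serving the
hypothesis `hPN` of the aiming arithmetic (`exists_isotropic_blockVectors'`,
`Motives/WeilFormIsotropicBlockVectorsAll`) and of the assembly of the partner-surface lemma
(`HodgeTheory/WeilClassesDescendingAssembly`, hypothesis (HR₁) of
`HodgeTheory/WeilClassesDescendingOfHodgeRiemannOfSegre`): there, for the rational degree-one model
`(M, G)` of a Weil-type abelian `2n`-fold (`M² = -d`, `G` alternating of Weil type,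
`Mᵀ G M = d G`), one needs RATIONAL `M`-stable subspaces `P`, `N ≤ ℚ^{4n}` of dimension `2n` each,
`P ∩ N = 0`, on which the symmetric form `S(x, y) = xᵀ G M y` is positive, resp. negative, definite
— whereas Hodge theory (Hodge–Riemann in degree one, van Geemen LNM 1594 Lemma 5.2 (4): "the
signature `(n, n)`" of the `K`-Hermitian form) delivers REAL definite subspaces `Wp`, `Wm ≤ ℝ^{4n}`
of dimension `2n`. This file proves the bridge (`exists_rational_signature_subspaces_of_real`):

**real definite `Wp`, `Wm` of dimension `2n` each ⟹ rational `M`-stable definite `P`, `N` of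
dimension `2n` each.**

Proof (van Geemen 5.3–5.4: "there exists a `K`-basis of `V` on which `H` is given by
`Σ aᵢ z̄ᵢ wᵢ`"; Sylvester's law of inertia). (1) `S` is symmetric, `S(Mx, My) = d S(x, y)`,
`S(x, Mx) = 0`, and `M` is skew-adjoint (`dotProduct_mulVec_mulVec_symm` …). (2) Gram–Schmidt over
`K = ℚ(M)`: an `M`-stable subspace `U` on which `S` is non-degenerate splits as an ORTHOGONAL sum of
`K`-lines `ℚ z ⊕ ℚ Mz` with Gram matrix `diag(S(z,z), d S(z,z))`, each definite; collecting the
positive and the negative lines gives `M`-stable, mutually orthogonal, definite `P ⊕ N = U`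
(`exists_signature_splitting`, by induction on `dim U`, the step being `signature_adjoin_line`).
(3) Non-degeneracy of `S` on `ℚ^{4n}` follows from the real hypothesis (`Wp ⊕ Wm = ℝ^{4n}`).
(4) Inertia: `S`-orthogonal rational bases of `P` and `N` (`LinearMap.BilinForm.exists_orthogonal_basis`)
form a real basis of `ℝ^{4n}`; a non-zero vector of `Wp` with vanishing `P`-coordinates would be a real
combination of the basis of `N`, of non-positive square — so `dim P ≥ 2n`, likewise `dim N ≥ 2n`,
and `dim P + dim N = 4n`.

Everything is proved; no definition and no named fact is introduced (D-0026).

## References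

* [vanGeemen1994HodgeAV] B. van Geemen, An introduction to the Hodge conjecture for abelian
  varieties, LNM 1594 (1994), Lemma 5.2 (2)–(4), 5.3–5.4.
* [Lang2002] S. Lang, Algebra, 3rd ed. (2002), XV §4 (Sylvester's theorem), XV §5 (Hermitian forms).
-/

noncomputable section

namespace Literature.AlgebraicGeometry.Motives

open Module

/-! ### Abstract Weil forms: a skew-adjoint `T` with `T² = -d` and a symmetric `S` with `S(Tx, Ty) = d S(x, y)` -/

section Abstract

variable {V : Type*} [AddCommGroup V] [Module ℚ V] {d : ℚ}

/-- `T` is skew-adjoint for `S`: `S(Tx, y) = -S(x, Ty)` (from `S(Tx, Ty) = d S(x,y)` and `T² = -d`).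
[cite: vanGeemen1994HodgeAV, Lemma 5.2 (2)] -/
theorem weilForm_skew (hd : d ≠ 0) (T : V →ₗ[ℚ] V) (S : LinearMap.BilinForm ℚ V)
    (hTT : ∀ x, T (T x) = -(d • x)) (hST : ∀ x y, S (T x) (T y) = d * S x y) (x y : V) :
    S (T x) y = -S x (T y) := by
  have hy : T (-(d⁻¹ • T y)) = y := by
    rw [map_neg, map_smul, hTT, smul_neg, neg_neg, smul_smul, inv_mul_cancel₀ hd, one_smul]
  conv_lhs => rw [← hy, hST]
  rw [map_neg, map_smul, smul_eq_mul]
  field_simp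

/-- The square of a vector of the `K`-line `ℚ z ⊕ ℚ Tz`: `S(αz + βTz, αz + βTz) = (α² + dβ²) S(z,z)`.
[cite: vanGeemen1994HodgeAV, 5.3] -/
theorem weilForm_line_self (T : V →ₗ[ℚ] V) (S : LinearMap.BilinForm ℚ V)
    (hsymm : ∀ x y, S x y = S y x) (hST : ∀ x y, S (T x) (T y) = d * S x y)
    (hiso : ∀ x, S x (T x) = 0) (z : V) (a b : ℚ) :
    S (a • z + b • T z) (a • z + b • T z) = (a * a + d * (b * b)) * S z z := by
  have h1 : S (T z) z = 0 := by rw [hsymm, hiso]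
  simp only [map_add, map_smul, LinearMap.add_apply, LinearMap.smul_apply, smul_eq_mul, hiso, h1,
    hST]
  ring

/-- **Adjoining a definite `K`-line** (the induction step of the Gram–Schmidt process over `K`).
Let `U` be `T`-stable, `z ∈ U` with `ε S(z,z) > 0` (`ε = ±1`), `U' = U ∩ z^⊥ ∩ (Tz)^⊥`, and let
`A ⊕ B = U'` be a `T`-stable orthogonal splitting with `ε S > 0` on `A ∖ 0`. Then
`A' = A ⊕ (ℚ z ⊕ ℚ Tz)` and `B` split `U` in the same manner. [cite: vanGeemen1994HodgeAV, 5.3–5.4] -/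
theorem signature_adjoin_line (hd : 0 < d) (T : V →ₗ[ℚ] V) (S : LinearMap.BilinForm ℚ V)
    (hsymm : ∀ x y, S x y = S y x) (hTT : ∀ x, T (T x) = -(d • x))
    (hST : ∀ x y, S (T x) (T y) = d * S x y) (hiso : ∀ x, S x (T x) = 0)
    {U U' A B : Submodule ℚ V} {z : V} {ε : ℚ}
    (hzU : z ∈ U) (hUT : ∀ u ∈ U, T u ∈ U)
    (hU' : ∀ w, w ∈ U' ↔ w ∈ U ∧ S w z = 0 ∧ S w (T z) = 0)
    (hz : 0 < ε * S z z)
    (hA : A ≤ U') (hB : B ≤ U') (hAT : ∀ u ∈ A, T u ∈ A)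
    (hAB : A ⊓ B = ⊥) (hABU : A ⊔ B = U')
    (hApos : ∀ x ∈ A, x ≠ 0 → 0 < ε * S x x)
    (horth : ∀ x ∈ A, ∀ y ∈ B, S x y = 0) :
    A ⊔ Submodule.span ℚ {z, T z} ≤ U ∧
    (∀ u ∈ A ⊔ Submodule.span ℚ {z, T z}, T u ∈ A ⊔ Submodule.span ℚ {z, T z}) ∧
    (A ⊔ Submodule.span ℚ {z, T z}) ⊓ B = ⊥ ∧ (A ⊔ Submodule.span ℚ {z, T z}) ⊔ B = U ∧
    (∀ x ∈ A ⊔ Submodule.span ℚ {z, T z}, x ≠ 0 → 0 < ε * S x x) ∧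
    (∀ x ∈ A ⊔ Submodule.span ℚ {z, T z}, ∀ y ∈ B, S x y = 0) := by
  set L : Submodule ℚ V := Submodule.span ℚ {z, T z} with hL
  have hzz0 : S z z ≠ 0 := by
    intro h; rw [h, mul_zero] at hz; exact lt_irrefl _ hz
  have hTzz : S (T z) z = 0 := by rw [hsymm, hiso]
  have hTzTz : S (T z) (T z) = d * S z z := hST z z
  have hskew := weilForm_skew hd.ne' T S hTT hST
  -- membership in `L`
  have hmemL : ∀ {l : V}, l ∈ L → ∃ a b : ℚ, a • z + b • T z = l := fun hl ↦
    Submodule.mem_span_pair.1 hl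
  have hzL : z ∈ L := Submodule.subset_span (by simp)
  have hTzL : T z ∈ L := Submodule.subset_span (by simp)
  have hLU : L ≤ U := Submodule.span_le.2 (by
    intro x hx
    simp only [Set.mem_insert_iff, Set.mem_singleton_iff] at hx
    rcases hx with rfl | rfl
    · exact hzU
    · exact hUT _ hzU)
  have hU'U : U' ≤ U := fun w hw ↦ ((hU' w).1 hw).1
  -- elements of `U'` are orthogonal to `L`
  have horthL : ∀ w ∈ U', ∀ l ∈ L, S w l = 0 := by
    intro w hw l hl
    obtain ⟨a, b, rfl⟩ := hmemL hl
    obtain ⟨-, h1, h2⟩ := (hU' w).1 hw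
    rw [map_add, map_smul, map_smul, h1, h2, smul_zero, smul_zero, add_zero]
  -- `L ∩ U' = 0`
  have hLU' : ∀ l ∈ L, l ∈ U' → l = 0 := by
    intro l hl hlU'
    obtain ⟨a, b, rfl⟩ := hmemL hl
    obtain ⟨-, h1, h2⟩ := (hU' _).1 hlU'
    have e1 : S (a • z + b • T z) z = a * S z z := by
      rw [LinearMap.BilinForm.add_left, LinearMap.BilinForm.smul_left, LinearMap.BilinForm.smul_left,
        hTzz, mul_zero, add_zero]
    have e2 : S (a • z + b • T z) (T z) = b * (d * S z z) := by
      rw [LinearMap.BilinForm.add_left, LinearMap.BilinForm.smul_left, LinearMap.BilinForm.smul_left,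
        hiso, mul_zero, zero_add, hTzTz]
    rw [e1] at h1
    rw [e2] at h2
    have ha : a = 0 := (mul_eq_zero.1 h1).resolve_right hzz0
    have hb : b = 0 := (mul_eq_zero.1 h2).resolve_right (mul_ne_zero hd.ne' hzz0)
    rw [ha, hb, zero_smul, zero_smul, add_zero]
  -- the projection onto `U'` along `L`
  have hdecomp : ∀ v ∈ U, ∃ v' ∈ U', ∃ l ∈ L, v = v' + l := by
    intro v hv
    set a : ℚ := S v z / S z z with ha
    set b : ℚ := S v (T z) / (d * S z z) with hb
    refine ⟨v - (a • z + b • T z), ?_, a • z + b • T z, Submodule.add_mem _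
      (Submodule.smul_mem _ _ hzL) (Submodule.smul_mem _ _ hTzL), by abel⟩
    refine (hU' _).2 ⟨Submodule.sub_mem _ hv (hLU (Submodule.add_mem _
      (Submodule.smul_mem _ _ hzL) (Submodule.smul_mem _ _ hTzL))), ?_, ?_⟩
    · rw [LinearMap.BilinForm.sub_left, LinearMap.BilinForm.add_left, LinearMap.BilinForm.smul_left,
        LinearMap.BilinForm.smul_left, hTzz, mul_zero, add_zero, ha, div_mul_cancel₀ _ hzz0, sub_self]
    · rw [LinearMap.BilinForm.sub_left, LinearMap.BilinForm.add_left, LinearMap.BilinForm.smul_left,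
        LinearMap.BilinForm.smul_left, hiso, mul_zero, zero_add, hTzTz, hb,
        div_mul_cancel₀ _ (mul_ne_zero hd.ne' hzz0), sub_self]
  refine ⟨sup_le (hA.trans hU'U) hLU, ?_, ?_, ?_, ?_, ?_⟩
  · -- `T`-stability
    intro u hu
    obtain ⟨a, ha, l, hl, rfl⟩ := Submodule.mem_sup.1 hu
    rw [map_add]
    refine Submodule.add_mem _ (Submodule.mem_sup_left (hAT a ha)) (Submodule.mem_sup_right ?_)
    obtain ⟨α, β, rfl⟩ := hmemL hl
    rw [map_add, map_smul, map_smul, hTT, smul_neg, ← neg_smul, smul_smul]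
    exact Submodule.add_mem _ (Submodule.smul_mem _ _ hTzL) (Submodule.smul_mem _ _ hzL)
  · -- `(A ⊔ L) ⊓ B = ⊥`
    refine (Submodule.eq_bot_iff _).2 fun x hx ↦ ?_
    obtain ⟨hx1, hx2⟩ := Submodule.mem_inf.1 hx
    obtain ⟨a, ha, l, hl, rfl⟩ := Submodule.mem_sup.1 hx1
    have hlU' : l ∈ U' := by
      have h : a + l - a ∈ U' := Submodule.sub_mem _ (hB hx2) (hA ha)
      rwa [add_sub_cancel_left] at h
    have hl0 : l = 0 := hLU' l hl hlU'
    rw [hl0, add_zero] at hx2 ⊢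
    have : a ∈ A ⊓ B := Submodule.mem_inf.2 ⟨ha, hx2⟩
    rw [hAB] at this
    exact (Submodule.mem_bot ℚ).1 this
  · -- `(A ⊔ L) ⊔ B = U`
    refine le_antisymm (sup_le (sup_le (hA.trans hU'U) hLU) (hB.trans hU'U)) fun v hv ↦ ?_
    obtain ⟨v', hv', l, hl, rfl⟩ := hdecomp v hv
    rw [← hABU] at hv'
    obtain ⟨a, ha, b, hb, rfl⟩ := Submodule.mem_sup.1 hv'
    rw [add_assoc, add_comm b l, ← add_assoc]
    exact Submodule.add_mem _ (Submodule.mem_sup_left (Submodule.add_mem _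
      (Submodule.mem_sup_left ha) (Submodule.mem_sup_right hl))) (Submodule.mem_sup_right hb)
  · -- positivity
    intro x hx hx0
    obtain ⟨a, ha, l, hl, rfl⟩ := Submodule.mem_sup.1 hx
    have hal : S a l = 0 := horthL a (hA ha) l hl
    have hla : S l a = 0 := by rw [hsymm, hal]
    obtain ⟨α, β, rfl⟩ := hmemL hl
    have hll := weilForm_line_self T S hsymm hST hiso z α β
    have hsum : S (a + (α • z + β • T z)) (a + (α • z + β • T z)) =
        S a a + (α * α + d * (β * β)) * S z z := by
      rw [LinearMap.BilinForm.add_left, LinearMap.BilinForm.add_right, hal, add_zero,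
        LinearMap.BilinForm.add_right, hla, zero_add, hll]
    rw [hsum, mul_add]
    have hnn : 0 ≤ α * α + d * (β * β) := by nlinarith [mul_self_nonneg α, mul_self_nonneg β]
    have h2 : 0 ≤ ε * ((α * α + d * (β * β)) * S z z) := by
      rw [mul_left_comm]; exact mul_nonneg hnn hz.le
    by_cases ha0 : a = 0
    · subst ha0
      rw [LinearMap.BilinForm.zero_left, mul_zero, zero_add, mul_left_comm]
      refine mul_pos ?_ hz
      rcases hnn.lt_or_eq with h | h
      · exact h
      · exfalso
        have hα : α = 0 := by nlinarith [mul_self_nonneg α, mul_self_nonneg β]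
        have hβ : β * β = 0 := by nlinarith [mul_self_nonneg α, mul_self_nonneg β]
        rw [hα, mul_self_eq_zero.1 hβ, zero_smul, zero_smul, add_zero, zero_add] at hx0
        exact hx0 rfl
    · exact add_pos_of_pos_of_nonneg (hApos a ha ha0) h2
  · -- orthogonality to `B`
    intro x hx y hy
    obtain ⟨a, ha, l, hl, rfl⟩ := Submodule.mem_sup.1 hx
    rw [LinearMap.BilinForm.add_left, horth a ha y hy, zero_add, hsymm, horthL y (hB hy) l hl]

/-- **Gram–Schmidt over `K = ℚ(M)` with signs (van Geemen 5.3–5.4; Sylvester): a `T`-stable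
subspace on which the Weil form `S` is non-degenerate is an orthogonal sum `P ⊕ N` of `T`-stable
subspaces with `S` positive definite on `P` and negative definite on `N`.**
[cite: vanGeemen1994HodgeAV, 5.3–5.4] [cite: Lang2002, XV §4–§5] -/
theorem exists_signature_splitting [FiniteDimensional ℚ V] (hd : 0 < d) (T : V →ₗ[ℚ] V)
    (S : LinearMap.BilinForm ℚ V) (hsymm : ∀ x y, S x y = S y x) (hTT : ∀ x, T (T x) = -(d • x))
    (hST : ∀ x y, S (T x) (T y) = d * S x y) (hiso : ∀ x, S x (T x) = 0) :
    ∀ (k : ℕ) (U : Submodule ℚ V), finrank ℚ U ≤ k → (∀ u ∈ U, T u ∈ U) →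
      (∀ u ∈ U, (∀ v ∈ U, S u v = 0) → u = 0) →
      ∃ P N : Submodule ℚ V, P ≤ U ∧ N ≤ U ∧ (∀ u ∈ P, T u ∈ P) ∧ (∀ u ∈ N, T u ∈ N) ∧
        P ⊓ N = ⊥ ∧ P ⊔ N = U ∧ (∀ x ∈ P, x ≠ 0 → 0 < S x x) ∧ (∀ x ∈ N, x ≠ 0 → S x x < 0) ∧
        (∀ x ∈ P, ∀ y ∈ N, S x y = 0) := by
  have hskew := weilForm_skew hd.ne' T S hTT hST
  intro k
  induction k with
  | zero =>
    intro U hU _ _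
    have hU0 : U = ⊥ := Submodule.finrank_eq_zero.1 (Nat.le_zero.1 hU)
    subst hU0
    exact ⟨⊥, ⊥, le_rfl, le_rfl,
      fun u hu ↦ by rw [(Submodule.mem_bot ℚ).1 hu, map_zero]; exact Submodule.zero_mem _,
      fun u hu ↦ by rw [(Submodule.mem_bot ℚ).1 hu, map_zero]; exact Submodule.zero_mem _,
      inf_idem _, sup_idem _,
      fun x hx hx0 ↦ (hx0 ((Submodule.mem_bot ℚ).1 hx)).elim,
      fun x hx hx0 ↦ (hx0 ((Submodule.mem_bot ℚ).1 hx)).elim,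
      fun x hx y _ ↦ by rw [(Submodule.mem_bot ℚ).1 hx, LinearMap.BilinForm.zero_left]⟩
  | succ k ih =>
    intro U hUk hUT hUnd
    by_cases hUbot : U = ⊥
    · subst hUbot
      exact ⟨⊥, ⊥, le_rfl, le_rfl,
        fun u hu ↦ by rw [(Submodule.mem_bot ℚ).1 hu, map_zero]; exact Submodule.zero_mem _,
        fun u hu ↦ by rw [(Submodule.mem_bot ℚ).1 hu, map_zero]; exact Submodule.zero_mem _,
        inf_idem _, sup_idem _,
        fun x hx hx0 ↦ (hx0 ((Submodule.mem_bot ℚ).1 hx)).elim,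
        fun x hx hx0 ↦ (hx0 ((Submodule.mem_bot ℚ).1 hx)).elim,
        fun x hx y _ ↦ by rw [(Submodule.mem_bot ℚ).1 hx, LinearMap.BilinForm.zero_left]⟩
    -- a vector `z ∈ U` with `S z z ≠ 0`
    obtain ⟨z, hzU, hzz⟩ : ∃ z ∈ U, S z z ≠ 0 := by
      obtain ⟨u, hu, hu0⟩ := (Submodule.ne_bot_iff U).1 hUbot
      by_contra hcon'
      have hcon : ∀ x ∈ U, S x x = 0 := fun x hx ↦ by
        by_contra h
        exact hcon' ⟨x, hx, h⟩
      have hpol : ∀ x ∈ U, ∀ y ∈ U, S x y = 0 := by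
        intro x hx y hy
        have h := hcon (x + y) (Submodule.add_mem _ hx hy)
        rw [LinearMap.BilinForm.add_left, LinearMap.BilinForm.add_right, LinearMap.BilinForm.add_right,
          hcon x hx, hcon y hy, hsymm y x] at h
        linarith
      exact hu0 (hUnd u hu fun v hv ↦ hpol u hu v hv)
    -- the orthogonal complement `U'` of the line `ℚ z ⊕ ℚ Tz` in `U`
    set U' : Submodule ℚ V := U ⊓ LinearMap.ker (S.flip z) ⊓ LinearMap.ker (S.flip (T z)) with hU'def
    have hU' : ∀ w, w ∈ U' ↔ w ∈ U ∧ S w z = 0 ∧ S w (T z) = 0 := by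
      intro w
      simp only [hU'def, Submodule.mem_inf, LinearMap.mem_ker, LinearMap.BilinForm.flip_apply, and_assoc]
    have hU'U : U' ≤ U := fun w hw ↦ ((hU' w).1 hw).1
    have hU'T : ∀ u ∈ U', T u ∈ U' := by
      intro u hu
      obtain ⟨huU, h1, h2⟩ := (hU' u).1 hu
      refine (hU' _).2 ⟨hUT u huU, ?_, ?_⟩
      · rw [hskew, h2, neg_zero]
      · rw [hST, h1, mul_zero]
    have hTzz : S (T z) z = 0 := by rw [hsymm, hiso]
    have hzU' : z ∉ U' := fun h ↦ hzz ((hU' z).1 h).2.1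
    have hlt : U' < U := lt_of_le_of_ne hU'U fun h ↦ hzU' (h ▸ hzU)
    have hU'k : finrank ℚ U' ≤ k := by
      have := Submodule.finrank_lt_finrank_of_lt hlt
      omega
    -- the projection onto `U'`
    have hdecomp : ∀ v ∈ U, ∃ v' ∈ U', ∃ a b : ℚ, v = v' + (a • z + b • T z) := by
      intro v hv
      set a : ℚ := S v z / S z z with ha
      set b : ℚ := S v (T z) / (d * S z z) with hb
      refine ⟨v - (a • z + b • T z), ?_, a, b, by abel⟩
      refine (hU' _).2 ⟨Submodule.sub_mem _ hv (Submodule.add_mem _ (Submodule.smul_mem _ _ hzU)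
        (Submodule.smul_mem _ _ (hUT z hzU))), ?_, ?_⟩
      · rw [LinearMap.BilinForm.sub_left, LinearMap.BilinForm.add_left, LinearMap.BilinForm.smul_left,
          LinearMap.BilinForm.smul_left, hTzz, mul_zero, add_zero, ha, div_mul_cancel₀ _ hzz, sub_self]
      · rw [LinearMap.BilinForm.sub_left, LinearMap.BilinForm.add_left, LinearMap.BilinForm.smul_left,
          LinearMap.BilinForm.smul_left, hiso, mul_zero, zero_add, hST, hb,
          div_mul_cancel₀ _ (mul_ne_zero hd.ne' hzz), sub_self]
    have hU'nd : ∀ u ∈ U', (∀ v ∈ U', S u v = 0) → u = 0 := by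
      intro u hu hperp
      refine hUnd u (hU'U hu) fun v hv ↦ ?_
      obtain ⟨v', hv', a, b, rfl⟩ := hdecomp v hv
      obtain ⟨-, h1, h2⟩ := (hU' u).1 hu
      rw [LinearMap.BilinForm.add_right, hperp v' hv', LinearMap.BilinForm.add_right,
        LinearMap.BilinForm.smul_right, LinearMap.BilinForm.smul_right, h1, h2, mul_zero, mul_zero,
        add_zero, add_zero]
    obtain ⟨P', N', hP', hN', hP'T, hN'T, hPN', hPNU', hP'pos, hN'neg, horth'⟩ :=
      ih U' hU'k hU'T hU'nd
    rcases lt_or_gt_of_ne hzz with hneg | hpos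
    · -- `S z z < 0`: the line goes to `N`
      have hz : 0 < (-1 : ℚ) * S z z := by linarith
      obtain ⟨h1, h2, h3, h4, h5, h6⟩ := signature_adjoin_line hd T S hsymm hTT hST hiso (ε := -1)
        hzU hUT hU' hz hN' hP' hN'T (by rw [inf_comm, hPN']) (by rw [sup_comm, hPNU'])
        (fun x hx hx0 ↦ by have := hN'neg x hx hx0; linarith)
        (fun x hx y hy ↦ by rw [hsymm]; exact horth' y hy x hx)
      refine ⟨P', N' ⊔ Submodule.span ℚ {z, T z}, hP'.trans hU'U, h1, hP'T, h2, by rw [inf_comm, h3],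
        by rw [sup_comm, h4], hP'pos, fun x hx hx0 ↦ ?_, fun x hx y hy ↦ ?_⟩
      · have := h5 x hx hx0; linarith
      · rw [hsymm]; exact h6 y hy x hx
    · -- `0 < S z z`: the line goes to `P`
      have hz : 0 < (1 : ℚ) * S z z := by linarith
      obtain ⟨h1, h2, h3, h4, h5, h6⟩ := signature_adjoin_line hd T S hsymm hTT hST hiso (ε := 1)
        hzU hUT hU' hz hP' hN' hP'T hPN' hPNU'
        (fun x hx hx0 ↦ by have := hP'pos x hx hx0; linarith) horth'
      refine ⟨P' ⊔ Submodule.span ℚ {z, T z}, N', h1, hN'.trans hU'U, h2, hN'T, h3, h4,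
        fun x hx hx0 ↦ ?_, hN'neg, h6⟩
      have := h5 x hx hx0; linarith

end Abstract

/-! ### Sylvester's inertia count against real definite subspaces -/

section Real

variable {ι : Type} [Fintype ι]

/-- **Inertia**: if a real basis `e = (b, c)` of `ℝ^ι` indexed by `Fin p ⊕ Fin q` has its
`c`-vectors pairwise `S`-orthogonal of non-positive square, then every subspace on which `S` is
positive definite has dimension `≤ p` (a non-zero vector with vanishing `b`-coordinates is a
combination of the `c`'s). [cite: Lang2002, XV §4] -/
theorem finrank_le_of_posDef_of_basis {p q : ℕ} (B : Module.Basis (Fin p ⊕ Fin q) ℝ (ι → ℝ))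
    (Sr : LinearMap.BilinForm ℝ (ι → ℝ))
    (horth : ∀ j j' : Fin q, j ≠ j' → Sr (B (Sum.inr j)) (B (Sum.inr j')) = 0)
    (hnonpos : ∀ j : Fin q, Sr (B (Sum.inr j)) (B (Sum.inr j)) ≤ 0)
    (W : Submodule ℝ (ι → ℝ)) (hW : ∀ x ∈ W, x ≠ 0 → 0 < Sr x x) : finrank ℝ W ≤ p := by
  classical
  by_contra hlt
  rw [not_le] at hlt
  -- the `b`-coordinates, restricted to `W`, have a kernel
  let π : (ι → ℝ) →ₗ[ℝ] (Fin p → ℝ) :=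
    (LinearMap.funLeft ℝ ℝ (Sum.inl : Fin p → Fin p ⊕ Fin q)) ∘ₗ Finsupp.lcoeFun ∘ₗ B.repr.toLinearMap
  have hπ : ∀ w j, π w j = B.repr w (Sum.inl j) := fun w j ↦ rfl
  have hker : LinearMap.ker (π ∘ₗ W.subtype) ≠ ⊥ :=
    LinearMap.ker_ne_bot_of_finrank_lt (by simpa using hlt)
  obtain ⟨w, hwk, hw0⟩ := Submodule.exists_mem_ne_zero_of_ne_bot hker
  have hw0' : (w : ι → ℝ) ≠ 0 := fun h ↦ hw0 (Subtype.ext h)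
  have hcoord : ∀ j, B.repr (w : ι → ℝ) (Sum.inl j) = 0 := fun j ↦ by
    have h := congrFun (LinearMap.mem_ker.1 hwk) j
    rwa [LinearMap.comp_apply, Submodule.subtype_apply, hπ] at h
  -- `w` is a combination of the `c`'s
  set r : Fin q → ℝ := fun j ↦ B.repr (w : ι → ℝ) (Sum.inr j) with hr
  have hw : (w : ι → ℝ) = ∑ j, r j • B (Sum.inr j) := by
    conv_lhs => rw [← B.sum_repr (w : ι → ℝ)]
    rw [Fintype.sum_sum_type]
    simp [hcoord, hr]
  -- its square is `Σ r_j² S(c_j, c_j) ≤ 0`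
  have hsq : Sr (w : ι → ℝ) (w : ι → ℝ) = ∑ j, r j * r j * Sr (B (Sum.inr j)) (B (Sum.inr j)) := by
    rw [hw, LinearMap.BilinForm.sum_left]
    refine Finset.sum_congr rfl fun j _ ↦ ?_
    rw [LinearMap.BilinForm.smul_left, LinearMap.BilinForm.sum_right,
      Finset.sum_eq_single j (fun j' _ hj' ↦ by rw [LinearMap.BilinForm.smul_right, horth j j' (Ne.symm hj'), mul_zero])
        (fun h ↦ (h (Finset.mem_univ j)).elim), LinearMap.BilinForm.smul_right]
    ring
  have hle : Sr (w : ι → ℝ) (w : ι → ℝ) ≤ 0 := by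
    rw [hsq]
    exact Finset.sum_nonpos fun j _ ↦ mul_nonpos_iff.2 (Or.inl ⟨mul_self_nonneg _, hnonpos j⟩)
  exact absurd (hW _ w.2 hw0') (not_lt.2 hle)

end Real

/-! ### The coordinate Weil form `S(x, y) = xᵀ G M y` and its real extension -/

section Concrete

variable {ι : Type} [Fintype ι] {d : ℚ} {M G : Matrix ι ι ℚ}

/-- `x ⬝ G x = 0` for `G` alternating. [folklore] -/
theorem dotProduct_mulVec_self_eq_zero_of_alt
    (hGt : ∀ x y : ι → ℚ, y ⬝ᵥ G.mulVec x = -(x ⬝ᵥ G.mulVec y)) (x : ι → ℚ) :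
    x ⬝ᵥ G.mulVec x = 0 := by
  have h := hGt x x; linarith

/-- `Mx ⬝ G y = -(x ⬝ G (M y))` (`M² = -d`, `Mᵀ G M = d G`). [cite: vanGeemen1994HodgeAV, Lemma 5.2 (1)–(2)] -/
theorem mulVec_dotProduct_mulVec_eq_neg (hd : d ≠ 0) (hM : ∀ v, M.mulVec (M.mulVec v) = -(d • v))
    (hW : ∀ x y : ι → ℚ, M.mulVec x ⬝ᵥ G.mulVec (M.mulVec y) = d * (x ⬝ᵥ G.mulVec y))
    (x y : ι → ℚ) : M.mulVec x ⬝ᵥ G.mulVec y = -(x ⬝ᵥ G.mulVec (M.mulVec y)) := by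
  have hy : M.mulVec (-(d⁻¹ • M.mulVec y)) = y := by
    rw [Matrix.mulVec_neg, Matrix.mulVec_smul, hM, smul_neg, neg_neg, smul_smul, inv_mul_cancel₀ hd,
      one_smul]
  conv_lhs => rw [← hy, hW]
  rw [Matrix.mulVec_neg, Matrix.mulVec_smul, dotProduct_neg, dotProduct_smul, smul_eq_mul]
  field_simp

/-- **Symmetry of `S(x, y) = xᵀ G M y`.** [cite: vanGeemen1994HodgeAV, Lemma 5.2 (2)] -/
theorem dotProduct_mulVec_mulVec_symm (hd : d ≠ 0) (hM : ∀ v, M.mulVec (M.mulVec v) = -(d • v))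
    (hGt : ∀ x y : ι → ℚ, y ⬝ᵥ G.mulVec x = -(x ⬝ᵥ G.mulVec y))
    (hW : ∀ x y : ι → ℚ, M.mulVec x ⬝ᵥ G.mulVec (M.mulVec y) = d * (x ⬝ᵥ G.mulVec y))
    (x y : ι → ℚ) : y ⬝ᵥ G.mulVec (M.mulVec x) = x ⬝ᵥ G.mulVec (M.mulVec y) := by
  rw [hGt (M.mulVec x) y, mulVec_dotProduct_mulVec_eq_neg hd hM hW, neg_neg]

/-- **Rational `M`-stable signature subspaces from real ones — the bridge from Hodge–Riemann in
degree one (real signature `(2n, 2n)` of `S(x, y) = xᵀ G M y`) to the hypothesis `hPN` of the aiming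
arithmetic (`exists_isotropic_blockVectors'`).** Let `M² = -d` (`d > 0`), `G` alternating with
`G(Mx, My) = d G(x, y)` on `ℚ^ι`, `|ι| = 4n`, and suppose `ℝ^ι` contains subspaces `Wp`, `Wm` of
dimension `2n` each on which the real extension of `S` is positive, resp. negative, definite. Then
there are `M`-stable subspaces `P`, `N ≤ ℚ^ι` of dimension `2n` each, `P ∩ N = 0`, with `S`
positive definite on `P` and negative definite on `N`.
[cite: vanGeemen1994HodgeAV, Lemma 5.2 (4) and 5.3–5.4] [cite: Lang2002, XV §4–§5] -/
theorem exists_rational_signature_subspaces_of_real [DecidableEq ι] (hd : 0 < d)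
    (hM : ∀ v, M.mulVec (M.mulVec v) = -(d • v))
    (hGt : ∀ x y : ι → ℚ, y ⬝ᵥ G.mulVec x = -(x ⬝ᵥ G.mulVec y))
    (hW : ∀ x y : ι → ℚ, M.mulVec x ⬝ᵥ G.mulVec (M.mulVec y) = d * (x ⬝ᵥ G.mulVec y))
    (n : ℕ) (hcard : Fintype.card ι = 4 * n)
    (Wp Wm : Submodule ℝ (ι → ℝ)) (hWp : finrank ℝ Wp = 2 * n) (hWm : finrank ℝ Wm = 2 * n)
    (hpos : ∀ x ∈ Wp, x ≠ 0 →
      0 < x ⬝ᵥ (G.map (fun t : ℚ ↦ (t : ℝ))).mulVec ((M.map (fun t : ℚ ↦ (t : ℝ))).mulVec x))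
    (hneg : ∀ x ∈ Wm, x ≠ 0 →
      x ⬝ᵥ (G.map (fun t : ℚ ↦ (t : ℝ))).mulVec ((M.map (fun t : ℚ ↦ (t : ℝ))).mulVec x) < 0) :
    ∃ P N : Submodule ℚ (ι → ℚ), (∀ v ∈ P, M.mulVec v ∈ P) ∧ (∀ v ∈ N, M.mulVec v ∈ N) ∧
      finrank ℚ P = 2 * n ∧ finrank ℚ N = 2 * n ∧ P ⊓ N = ⊥ ∧
      (∀ x ∈ P, x ≠ 0 → 0 < x ⬝ᵥ G.mulVec (M.mulVec x)) ∧
      (∀ x ∈ N, x ≠ 0 → x ⬝ᵥ G.mulVec (M.mulVec x) < 0) := by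
  classical
  -- the rational form `S` and the operator `T`
  set S : LinearMap.BilinForm ℚ (ι → ℚ) := Matrix.toBilin' (G * M) with hSdef
  set T : (ι → ℚ) →ₗ[ℚ] (ι → ℚ) := Matrix.mulVecLin M with hTdef
  have hS : ∀ x y, S x y = x ⬝ᵥ G.mulVec (M.mulVec y) := fun x y ↦ by
    rw [hSdef, Matrix.toBilin'_apply', Matrix.mulVec_mulVec]
  have hT : ∀ x, T x = M.mulVec x := fun x ↦ by rw [hTdef, Matrix.mulVecLin_apply]
  have hsymm : ∀ x y, S x y = S y x := fun x y ↦ by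
    rw [hS, hS, dotProduct_mulVec_mulVec_symm hd.ne' hM hGt hW y x]
  have hTT : ∀ x, T (T x) = -(d • x) := fun x ↦ by rw [hT, hT, hM]
  have hST : ∀ x y, S (T x) (T y) = d * S x y := fun x y ↦ by
    rw [hS, hS, hT, hT, hM, Matrix.mulVec_neg, Matrix.mulVec_smul, dotProduct_neg, dotProduct_smul,
      smul_eq_mul, mulVec_dotProduct_mulVec_eq_neg hd.ne' hM hW]
    ring
  have hiso : ∀ x, S x (T x) = 0 := fun x ↦ by
    rw [hS, hT, hM, Matrix.mulVec_neg, Matrix.mulVec_smul, dotProduct_neg, dotProduct_smul,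
      dotProduct_mulVec_self_eq_zero_of_alt hGt, smul_zero, neg_zero]
  -- the real form and the cast map
  set f : ℚ →+* ℝ := Rat.castHom ℝ with hfdef
  set Sr : LinearMap.BilinForm ℝ (ι → ℝ) := Matrix.toBilin' ((G * M).map f) with hSrdef
  have hSr : ∀ x : ι → ℝ, Sr x x =
      x ⬝ᵥ (G.map (fun t : ℚ ↦ (t : ℝ))).mulVec ((M.map (fun t : ℚ ↦ (t : ℝ))).mulVec x) := by
    intro x
    rw [hSrdef, Matrix.toBilin'_apply', Matrix.map_mul, ← Matrix.mulVec_mulVec]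
    rfl
  let φ : (ι → ℚ) →ₗ[ℚ] (ι → ℝ) :=
    { toFun := fun x i ↦ (x i : ℝ)
      map_add' := fun x y ↦ by funext i; simp
      map_smul' := fun a x ↦ by funext i; simp [Rat.smul_def] }
  have hφ : ∀ x i, φ x i = (x i : ℝ) := fun x i ↦ rfl
  have hφinj : Function.Injective φ := fun x y hxy ↦ by
    funext i
    have h := congrFun hxy i
    rw [hφ, hφ] at h
    exact_mod_cast h
  have hcastS : ∀ x y, Sr (φ x) (φ y) = ((S x y : ℚ) : ℝ) := by
    intro x y
    rw [hSrdef, hSdef, Matrix.toBilin'_apply', Matrix.toBilin'_apply']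
    have h1 : ((G * M).map f).mulVec (φ y) = f ∘ (G * M).mulVec y := by
      funext i
      exact (RingHom.map_mulVec f (G * M) y i).symm
    rw [h1]
    exact (RingHom.map_dotProduct f x ((G * M).mulVec y)).symm
  -- symmetry of the real form (the matrix `G M` is symmetric)
  have hGM : (G * M).transpose = G * M := by
    ext i j
    rw [Matrix.transpose_apply, ← Matrix.toBilin'_single (G * M) j i, ← Matrix.toBilin'_single (G * M) i j]
    exact hsymm _ _
  have hGM' : ∀ i j, (G * M) i j = (G * M) j i := fun i j ↦ by
    conv_lhs => rw [← hGM]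
    rfl
  have hSrsymm : ∀ x y : ι → ℝ, Sr x y = Sr y x := by
    intro x y
    rw [hSrdef, Matrix.toBilin'_apply, Matrix.toBilin'_apply, Finset.sum_comm]
    refine Finset.sum_congr rfl fun a _ ↦ Finset.sum_congr rfl fun b _ ↦ ?_
    rw [Matrix.map_apply, Matrix.map_apply, hGM' b a]
    ring
  -- (3) non-degeneracy of `S` from the real hypothesis
  haveI : FiniteDimensional ℝ (ι → ℝ) := inferInstance
  have hWW : Wp ⊓ Wm = ⊥ := by
    refine (Submodule.eq_bot_iff _).2 fun x hx ↦ ?_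
    by_contra hx0
    have h1 := hpos x hx.1 hx0
    have h2 := hneg x hx.2 hx0
    linarith
  have hWtop : Wp ⊔ Wm = ⊤ := by
    apply Submodule.eq_top_of_finrank_eq
    have h := Submodule.finrank_sup_add_finrank_inf_eq Wp Wm
    rw [hWW, finrank_bot, add_zero, hWp, hWm] at h
    rw [h, Module.finrank_fintype_fun_eq_card, hcard]
    ring
  have hnd : ∀ u : ι → ℚ, (∀ v, S u v = 0) → u = 0 := by
    intro u hu
    -- `Sr (φ u) = 0`
    have hfun : ∀ y : ι → ℝ, Sr (φ u) y = 0 := by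
      have hlin : Sr (φ u) = 0 := by
        refine (Pi.basisFun ℝ ι).ext fun i ↦ ?_
        rw [Pi.basisFun_apply, LinearMap.zero_apply]
        have hs : (Pi.single i (1 : ℝ) : ι → ℝ) = φ (Pi.single i 1) := by
          funext j
          rw [hφ]
          by_cases hij : j = i
          · subst hij; simp
          · simp [Pi.single_eq_of_ne hij]
        rw [hs, hcastS, hu, Rat.cast_zero]
      intro y
      rw [hlin, LinearMap.zero_apply]
    have hmem : φ u ∈ Wp ⊔ Wm := by rw [hWtop]; exact Submodule.mem_top
    obtain ⟨a, ha, b, hb, hab⟩ := Submodule.mem_sup.1 hmem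
    have e1 := hfun a
    have e2 := hfun b
    rw [← hab, LinearMap.BilinForm.add_left] at e1 e2
    rw [hSrsymm b a] at e1
    -- `Sr a a = Sr b b`, the first `≥ 0`, the second `≤ 0`
    have ha0 : a = 0 := by
      by_contra ha0
      have h1 : 0 < Sr a a := by rw [hSr]; exact hpos a ha ha0
      have h2 : Sr b b ≤ 0 := by
        by_cases hb0 : b = 0
        · rw [hb0, LinearMap.BilinForm.zero_left]
        · rw [hSr]; exact (hneg b hb hb0).le
      linarith
    have hb0 : b = 0 := by
      by_contra hb0
      have h2 : Sr b b < 0 := by rw [hSr]; exact hneg b hb hb0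
      rw [ha0, LinearMap.BilinForm.zero_left, zero_add] at e2
      linarith
    apply hφinj
    rw [map_zero, ← hab, ha0, hb0, add_zero]
  -- (2) the splitting of `ℚ^ι`
  obtain ⟨P, N, -, -, hPT, hNT, hPN, hPNtop, hPpos, hNneg, horth⟩ :=
    exists_signature_splitting hd T S hsymm hTT hST hiso (finrank ℚ (ι → ℚ)) ⊤
      (finrank_top ℚ (ι → ℚ)).le (fun u _ ↦ Submodule.mem_top)
      (fun u _ h ↦ hnd u fun v ↦ h v Submodule.mem_top)
  -- (4) inertia: `finrank P = finrank N = 2n`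
  have hsum : finrank ℚ P + finrank ℚ N = 4 * n := by
    have h := Submodule.finrank_sup_add_finrank_inf_eq P N
    rw [hPN, finrank_bot, add_zero, hPNtop, finrank_top, Module.finrank_fintype_fun_eq_card, hcard] at h
    exact h.symm
  -- orthogonal bases of `P` and `N`
  have hsymmP : LinearMap.IsSymm (S.restrict P) := ⟨fun x y ↦ hsymm x y⟩
  have hsymmN : LinearMap.IsSymm (S.restrict N) := ⟨fun x y ↦ hsymm x y⟩
  have hqsmul : ∀ (a : ℚ) (y : ι → ℝ), a • y = (a : ℝ) • y := fun a y ↦ by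
    funext i
    simp [Rat.smul_def]
  obtain ⟨bP, hbP⟩ := LinearMap.BilinForm.exists_orthogonal_basis hsymmP
  obtain ⟨bN, hbN⟩ := LinearMap.BilinForm.exists_orthogonal_basis hsymmN
  -- the real family `e = (φ bP, φ bN)` is a basis of `ℝ^ι`
  set e : Fin (finrank ℚ P) ⊕ Fin (finrank ℚ N) → (ι → ℝ) :=
    Sum.elim (fun j ↦ φ (bP j : ι → ℚ)) (fun j ↦ φ (bN j : ι → ℚ)) with he
  have hspanP : ∀ x ∈ P, φ x ∈ Submodule.span ℝ (Set.range e) := by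
    intro x hx
    have hrepr : (x : ι → ℚ) = ∑ j, bP.repr ⟨x, hx⟩ j • (bP j : ι → ℚ) := by
      have h := congrArg Subtype.val (bP.sum_repr ⟨x, hx⟩)
      simp only [Submodule.coe_sum, Submodule.coe_smul] at h
      exact h.symm
    rw [hrepr, map_sum]
    refine Submodule.sum_mem _ fun j _ ↦ ?_
    rw [map_smul]
    rw [hqsmul]
    exact Submodule.smul_mem _ _ (Submodule.subset_span ⟨Sum.inl j, rfl⟩)
  have hspanN : ∀ x ∈ N, φ x ∈ Submodule.span ℝ (Set.range e) := by
    intro x hx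
    have hrepr : (x : ι → ℚ) = ∑ j, bN.repr ⟨x, hx⟩ j • (bN j : ι → ℚ) := by
      have h := congrArg Subtype.val (bN.sum_repr ⟨x, hx⟩)
      simp only [Submodule.coe_sum, Submodule.coe_smul] at h
      exact h.symm
    rw [hrepr, map_sum]
    refine Submodule.sum_mem _ fun j _ ↦ ?_
    rw [map_smul]
    rw [hqsmul]
    exact Submodule.smul_mem _ _ (Submodule.subset_span ⟨Sum.inr j, rfl⟩)
  have hspan : ⊤ ≤ Submodule.span ℝ (Set.range e) := by
    have hsingle : ∀ i, (Pi.single i (1 : ℝ) : ι → ℝ) ∈ Submodule.span ℝ (Set.range e) := by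
      intro i
      have hs : (Pi.single i (1 : ℝ) : ι → ℝ) = φ (Pi.single i 1) := by
        funext j
        rw [hφ]
        by_cases hij : j = i
        · subst hij; simp
        · simp [Pi.single_eq_of_ne hij]
      have hmem : (Pi.single i (1 : ℚ) : ι → ℚ) ∈ P ⊔ N := by rw [hPNtop]; exact Submodule.mem_top
      obtain ⟨x, hx, y, hy, hxy⟩ := Submodule.mem_sup.1 hmem
      rw [hs, ← hxy, map_add]
      exact Submodule.add_mem _ (hspanP x hx) (hspanN y hy)
    intro w _
    rw [← (Pi.basisFun ℝ ι).sum_repr w]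
    exact Submodule.sum_mem _ fun i _ ↦ Submodule.smul_mem _ _ (by rw [Pi.basisFun_apply]; exact hsingle i)
  have hcard' : Fintype.card (Fin (finrank ℚ P) ⊕ Fin (finrank ℚ N)) = finrank ℝ (ι → ℝ) := by
    rw [Fintype.card_sum, Fintype.card_fin, Fintype.card_fin, Module.finrank_fintype_fun_eq_card, hcard,
      ← hsum]
  have hli : LinearIndependent ℝ e := linearIndependent_of_top_le_span_of_card_eq_finrank hspan hcard'
  set B : Module.Basis (Fin (finrank ℚ P) ⊕ Fin (finrank ℚ N)) ℝ (ι → ℝ) := Module.Basis.mk hli hspan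
    with hB
  have hBe : ∀ k, B k = e k := fun k ↦ by rw [hB, Module.Basis.mk_apply]
  -- values of `Sr` on the basis
  have hNN : ∀ j j' : Fin (finrank ℚ N), j ≠ j' → Sr (B (Sum.inr j)) (B (Sum.inr j')) = 0 := by
    intro j j' hjj'
    rw [hBe, hBe, he, Sum.elim_inr, Sum.elim_inr, hcastS]
    have h : S (bN j : ι → ℚ) (bN j' : ι → ℚ) = 0 := hbN hjj'
    rw [h, Rat.cast_zero]
  have hPP : ∀ j j' : Fin (finrank ℚ P), j ≠ j' → Sr (B (Sum.inl j)) (B (Sum.inl j')) = 0 := by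
    intro j j' hjj'
    rw [hBe, hBe, he, Sum.elim_inl, Sum.elim_inl, hcastS]
    have h : S (bP j : ι → ℚ) (bP j' : ι → ℚ) = 0 := hbP hjj'
    rw [h, Rat.cast_zero]
  have hNle : ∀ j : Fin (finrank ℚ N), Sr (B (Sum.inr j)) (B (Sum.inr j)) ≤ 0 := by
    intro j
    rw [hBe, he, Sum.elim_inr, hcastS]
    have h := hNneg (bN j : ι → ℚ) (bN j).2 (fun h0 ↦ bN.ne_zero j (Subtype.ext h0))
    exact_mod_cast h.le
  have hPge : ∀ j : Fin (finrank ℚ P), 0 ≤ Sr (B (Sum.inl j)) (B (Sum.inl j)) := by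
    intro j
    rw [hBe, he, Sum.elim_inl, hcastS]
    have h := hPpos (bP j : ι → ℚ) (bP j).2 (fun h0 ↦ bP.ne_zero j (Subtype.ext h0))
    exact_mod_cast h.le
  -- `2n ≤ p` from `Wp`, `2n ≤ q` from `Wm`
  have h1 : finrank ℝ Wp ≤ finrank ℚ P :=
    finrank_le_of_posDef_of_basis B Sr hNN hNle Wp (fun x hx hx0 ↦ by rw [hSr]; exact hpos x hx hx0)
  have h2 : finrank ℝ Wm ≤ finrank ℚ N := by
    refine finrank_le_of_posDef_of_basis
      (B.reindex (Equiv.sumComm (Fin (finrank ℚ P)) (Fin (finrank ℚ N)))) (-Sr)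
      (fun j j' hjj' ↦ ?_) (fun j ↦ ?_) Wm (fun x hx hx0 ↦ ?_)
    · rw [Module.Basis.reindex_apply, Module.Basis.reindex_apply, Equiv.sumComm_symm, Equiv.sumComm_apply,
        Sum.swap_inr, Sum.swap_inr, LinearMap.neg_apply, LinearMap.neg_apply, hPP j j' hjj', neg_zero]
    · rw [Module.Basis.reindex_apply, Equiv.sumComm_symm, Equiv.sumComm_apply, Sum.swap_inr,
        LinearMap.neg_apply, LinearMap.neg_apply, neg_nonpos]
      exact hPge j
    · rw [LinearMap.neg_apply, LinearMap.neg_apply, hSr]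
      linarith [hneg x hx hx0]
  have hp2 : finrank ℚ P = 2 * n := by omega
  have hq2 : finrank ℚ N = 2 * n := by omega
  refine ⟨P, N, fun v hv ↦ ?_, fun v hv ↦ ?_, hp2, hq2, hPN, fun x hx hx0 ↦ ?_, fun x hx hx0 ↦ ?_⟩
  · rw [← hT]; exact hPT v hv
  · rw [← hT]; exact hNT v hv
  · rw [← hS]; exact hPpos x hx hx0
  · rw [← hS]; exact hNneg x hx hx0

end Concrete

end Literature.AlgebraicGeometry.Motives

end
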